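import Summits.CriticalPhenomena.PercolationContinuityZ3.Theorems.PercNearOneGluingNoHeavyLowerTailTformPairExchange
import HarnessLib

/-!
# `NoHeavyLowerTail` (stmt-CriticalPhenomena-4575) — the QUANTITATIVE gluing lemma for relay counts
# (Kozma–Nitzan's eq. (9) with `{· ↔ b}` replaced by `{N_· > j}`)

Support file (prover `prim-hp-5`, hull-port cell, gen 11; `--supports stmt-CriticalPhenomena-4575`).  No definitions,
no named facts, no sorries.  `μ = prodBernoulli w`, relays `A`, level `j`, `N_v = |{a ∈ A : v ↔ a}|`, `Φ(v) = μ(N_v ≤ j)`;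
for a pair `B = {y, z}` of ARBITRARY vertices: `{x ~ B} = {x ↔ y} ∪ {x ↔ z}`, `N_B = |{a ∈ A : y ↔ a ∨ z ↔ a}|`
(the relay count of the glued pair), and the glued lightness of a vertex `x`,
`Φ_{K/B}(x) = μ( (x ~ B ∧ N_B ≤ j) ∨ (x ≁ B ∧ N_x ≤ j) )`.

* `quantGluing_pair` (GL4 of memo OBSERVER-SET.md §24):
      `Φ_{K/B}(x) − μ(N_B ≤ j) ≥ min( Φ(x) − Φ(y), Φ(x) − Φ(z) )`
  — after gluing the pair, the advantage of `x` over the glued block is at least its advantage over the LIGHTER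
  member before gluing.  This is Kozma–Nitzan's Remark (9) after Lemma 4 (arXiv:2401.12397 pp. 9–10,
  `P_{G*}(ā↔b) − P_{G*}(a₃↔b) ≥ min_j [P_G(a_j↔b) − P_G(a₃↔b)]`) for relay counts; KN's printed derivation does not
  transfer (it uses `{a₁↔b} ∩ {a₁↮a₂} ⊆ {a₂↮b}`, false for counts: two light blocks may glue to a heavy one) — here it
  follows from the tree's pair-exchange form of Lemma 4, `gluingGain_le` (p193360): with
  `piv_v = μ(N_v ≤ j < N_B)` one has `Φ_{K/B}(x) = Φ(x) − gain_B(x)`, `μ(N_B ≤ j) = Φ(v) − piv_v` for `v = y, z`,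
  and `gain_B(x) ≤ max(piv_y, piv_z)`.
Census (seat gen 11, lab/h6_gl4.py): 0/2 325 (also 0/896 for three glued relays and 0/6 484 for the mixed form with
the threshold θ(z) of a non-relay member — those two are NOT proved here).
-/

noncomputable section

namespace Summit.CriticalPhenomena.PercolationContinuityZ3.Theorems

open MeasureTheory Set Literature.Probability.LatticeModels Literature.Probability.Percolation
open scoped Classical BigOperators

variable {V : Type*} [Fintype V]

/-- **Quantitative gluing lemma (KN eq. (9) for relay counts).**  For vertices `x, y, z`, relays `A`, level `j`,
with `{x ~ B} = {x ↔ y} ∪ {x ↔ z}` and `N_B = |{a ∈ A : y ↔ a ∨ z ↔ a}|`: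
`μ((x ~ B ∧ N_B ≤ j) ∨ (x ≁ B ∧ N_x ≤ j)) − μ(N_B ≤ j) ≥ min(μ(N_x ≤ j) − μ(N_y ≤ j), μ(N_x ≤ j) − μ(N_z ≤ j))`.
[cite: KozmaNitzan2024, Lemma 4 and Remark (9) (pp. 9–10)] -/
theorem quantGluing_pair (w : Sym2 V → unitInterval) (A : Finset V) (x y z : V) (j : ℕ) :
    min ((prodBernoulli w).real {ω : BondConfig V | (A.filter fun a => ω ∈ openConn x a).card ≤ j} -
          (prodBernoulli w).real {ω : BondConfig V | (A.filter fun a => ω ∈ openConn y a).card ≤ j})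
        ((prodBernoulli w).real {ω : BondConfig V | (A.filter fun a => ω ∈ openConn x a).card ≤ j} -
          (prodBernoulli w).real {ω : BondConfig V | (A.filter fun a => ω ∈ openConn z a).card ≤ j}) ≤
      (prodBernoulli w).real
          (((openConn x y ∪ openConn x z) ∩
              {ω : BondConfig V | (A.filter fun a => ω ∈ openConn y a ∨ ω ∈ openConn z a).card ≤ j}) ∪
            ((openConn x y ∪ openConn x z)ᶜ ∩
              {ω : BondConfig V | (A.filter fun a => ω ∈ openConn x a).card ≤ j})) -
        (prodBernoulli w).real
          {ω : BondConfig V | (A.filter fun a => ω ∈ openConn y a ∨ ω ∈ openConn z a).card ≤ j} := by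
  classical
  set μ := prodBernoulli w with hμ
  set XB : Set (BondConfig V) := openConn x y ∪ openConn x z with hXB
  set Lx : Set (BondConfig V) := {ω : BondConfig V | (A.filter fun a => ω ∈ openConn x a).card ≤ j} with hLx
  set Ly : Set (BondConfig V) := {ω : BondConfig V | (A.filter fun a => ω ∈ openConn y a).card ≤ j} with hLy
  set Lz : Set (BondConfig V) := {ω : BondConfig V | (A.filter fun a => ω ∈ openConn z a).card ≤ j} with hLz
  set LB : Set (BondConfig V) :=
    {ω : BondConfig V | (A.filter fun a => ω ∈ openConn y a ∨ ω ∈ openConn z a).card ≤ j} with hLB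
  -- the `{j < ·}` events of `gluingGain_le` are the complements
  have cx : {ω : BondConfig V | j < (A.filter fun a => ω ∈ openConn x a).card} = Lxᶜ := by
    ext ω; simp only [hLx, mem_setOf_eq, mem_compl_iff, not_le]
  have cy : {ω : BondConfig V | j < (A.filter fun a => ω ∈ openConn y a).card} = Lyᶜ := by
    ext ω; simp only [hLy, mem_setOf_eq, mem_compl_iff, not_le]
  have cz : {ω : BondConfig V | j < (A.filter fun a => ω ∈ openConn z a).card} = Lzᶜ := by
    ext ω; simp only [hLz, mem_setOf_eq, mem_compl_iff, not_le]
  have cB : {ω : BondConfig V | j < (A.filter fun a => ω ∈ openConn y a ∨ ω ∈ openConn z a).card} = LBᶜ := by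
    ext ω; simp only [hLB, mem_setOf_eq, mem_compl_iff, not_le]
  -- monotonicity of the relay counts: `N_y, N_z ≤ N_B`, and `N_x ≤ N_B` on `{x ~ B}`
  have hBy : LB ⊆ Ly := by
    intro ω hω
    simp only [hLy, hLB, mem_setOf_eq] at hω ⊢
    exact le_trans (Finset.card_le_card fun a ha => by
      rw [Finset.mem_filter] at ha ⊢; exact ⟨ha.1, Or.inl ha.2⟩) hω
  have hBz : LB ⊆ Lz := by
    intro ω hω
    simp only [hLz, hLB, mem_setOf_eq] at hω ⊢
    exact le_trans (Finset.card_le_card fun a ha => by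
      rw [Finset.mem_filter] at ha ⊢; exact ⟨ha.1, Or.inr ha.2⟩) hω
  have hBx : XB ∩ LB ⊆ Lx := by
    rintro ω ⟨hX, hB⟩
    simp only [hLx, hLB, mem_setOf_eq] at hB ⊢
    refine le_trans (Finset.card_le_card fun a ha => ?_) hB
    rw [Finset.mem_filter] at ha ⊢
    refine ⟨ha.1, ?_⟩
    rcases hX with h | h
    · exact Or.inl (show (openGraph ω).Reachable y a from (SimpleGraph.Reachable.symm h).trans ha.2)
    · exact Or.inr (show (openGraph ω).Reachable z a from (SimpleGraph.Reachable.symm h).trans ha.2)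
  have hmeas : ∀ s : Set (BondConfig V), MeasurableSet s := fun _ => MeasurableSet.of_discrete
  have hsplit : ∀ S T : Set (BondConfig V), μ.real S = μ.real (S ∩ T) + μ.real (S ∩ Tᶜ) := by
    intro S T
    rw [← measureReal_inter_add_sdiff (s := S) (hmeas T), Set.sdiff_eq]
  -- `Φ(x) = Φ_{K/B}(x) + gain`, gain = `μ(x ~ B, N_B > j, N_x ≤ j)`
  have hglued : μ.real ((XB ∩ LB) ∪ (XBᶜ ∩ Lx)) = μ.real (XB ∩ LB) + μ.real (XBᶜ ∩ Lx) := by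
    refine measureReal_union ?_ (hmeas _)
    exact Set.disjoint_left.2 fun ω h1 h2 => h2.1 h1.1
  have hx1 : μ.real Lx = μ.real (Lx ∩ XB) + μ.real (Lx ∩ XBᶜ) := hsplit Lx XB
  have hx2 : μ.real (Lx ∩ XB) = μ.real (Lx ∩ XB ∩ LB) + μ.real (Lx ∩ XB ∩ LBᶜ) := hsplit (Lx ∩ XB) LB
  have e1 : Lx ∩ XB ∩ LB = XB ∩ LB := by
    ext ω; constructor
    · rintro ⟨⟨_, hX⟩, hB⟩; exact ⟨hX, hB⟩
    · rintro ⟨hX, hB⟩; exact ⟨⟨hBx ⟨hX, hB⟩, hX⟩, hB⟩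
  have e2 : Lx ∩ XBᶜ = XBᶜ ∩ Lx := Set.inter_comm _ _
  have e3 : Lx ∩ XB ∩ LBᶜ = XB ∩ LBᶜ ∩ Lxᶜᶜ := by
    rw [compl_compl]; ext ω; constructor
    · rintro ⟨⟨hL, hX⟩, hB⟩; exact ⟨⟨hX, hB⟩, hL⟩
    · rintro ⟨⟨hX, hB⟩, hL⟩; exact ⟨⟨hL, hX⟩, hB⟩
  -- `μ(N_B ≤ j) = Φ(v) − piv_v`
  have hy1 : μ.real Ly = μ.real (Ly ∩ LB) + μ.real (Ly ∩ LBᶜ) := hsplit Ly LB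
  have hz1 : μ.real Lz = μ.real (Lz ∩ LB) + μ.real (Lz ∩ LBᶜ) := hsplit Lz LB
  have ey : Ly ∩ LB = LB := Set.inter_eq_right.2 hBy
  have ez : Lz ∩ LB = LB := Set.inter_eq_right.2 hBz
  -- `gain ≤ max(piv'_y, piv'_z)` with `piv'_v = μ(x ~ B, N_B > j, N_v ≤ j) ≤ piv_v = μ(N_v ≤ j, N_B > j)`
  have hgain := gluingGain_le w A x y z j
  simp only [← hμ, ← hXB, cx, cy, cz, cB] at hgain
  have hpy : μ.real (XB ∩ LBᶜ ∩ Lyᶜᶜ) ≤ μ.real (Ly ∩ LBᶜ) := by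
    rw [compl_compl]
    exact measureReal_mono (fun ω ⟨⟨_, hB⟩, hL⟩ => ⟨hL, hB⟩) (measure_ne_top μ _)
  have hpz : μ.real (XB ∩ LBᶜ ∩ Lzᶜᶜ) ≤ μ.real (Lz ∩ LBᶜ) := by
    rw [compl_compl]
    exact measureReal_mono (fun ω ⟨⟨_, hB⟩, hL⟩ => ⟨hL, hB⟩) (measure_ne_top μ _)
  rw [hglued, hx1, hx2, e1, e2, e3, hy1, hz1, ey, ez]
  rcases le_max_iff.1 hgain with h | h
  · exact min_le_of_left_le (by linarith)
  · exact min_le_of_right_le (by linarith)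

end Summit.CriticalPhenomena.PercolationContinuityZ3.Theorems

end
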